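import Literature.Geometry.Lorentzian.KerrAxialSymmetry
import HarnessLib

/-!
# Axial symmetry of the Kerr–Schild metric (covariant form)

`KerrAxialSymmetry.lean` proves the invariance of `r`, `Σ`, `H` and the equivariance of the null
vector `ℓ♯` under the axial rotations `R_α` of the Kerr–Schild chart, and deduces the equivariance
of the INVERSE metric. This file records the covariant statements: the Minkowski form, the null
covector and the Kerr–Schild metric itself are invariant,
`g_{M,a}(R_α x)(R_α v, R_α w) = g_{M,a}(x)(v, w)` — i.e. the `R_α` are isometries of Kerr (its
axial Killing symmetry `∂_φ`, O'Neill 1995, Ch. 2, §2.2).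

## References

* B. O'Neill, *The geometry of Kerr black holes*, 1995, Ch. 2, §2.2 (key `ONeill1995`).
* R. P. Kerr, A. Schild, 1965, §2 (key `KerrSchild1965`).
-/

noncomputable section

namespace Literature.Geometry.Lorentzian

/-- **The Minkowski form is invariant under the axial rotations**: `η(R_α v, R_α w) = η(v, w)`.
[cite: ONeill1983, Ch. 3, p. 55] -/
theorem Minkowski.bilin_axialRotation (α : ℝ) (v w : E4) :
    Minkowski.bilin (E4.axialRotation α v) (E4.axialRotation α w) = Minkowski.bilin v w := by
  have e3 : (2 : Fin 3).succ = (3 : Fin 4) := rfl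
  rw [Minkowski.bilin_apply, Minkowski.bilin_apply, Fin.sum_univ_three, Fin.sum_univ_three]
  simp only [Fin.succ_zero_eq_one, Fin.succ_one_eq_two, e3, E4.axialRotation_apply_zero,
    E4.axialRotation_apply_one, E4.axialRotation_apply_two, E4.axialRotation_apply_three]
  have h := Real.sin_sq_add_cos_sq α
  linear_combination (v 1 * w 1 + v 2 * w 2) * h

namespace Kerr

/-- **The Kerr–Schild null covector is invariant under the axial rotations**:
`ℓ(R_α x)(R_α v) = ℓ(x)(v)` (from `ℓ(w) = η(ℓ♯, w)`, the equivariance of `ℓ♯` and the invariance of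
`η`). Kerr–Schild 1965, §2. [cite: KerrSchild1965, §2] -/
theorem nullCovector_axialRotation (a α : ℝ) (x v : E4) :
    nullCovector a (E4.axialRotation α x) (E4.axialRotation α v) = nullCovector a x v := by
  rw [← bilin_nullVector, ← bilin_nullVector, nullVector_axialRotation,
    Minkowski.bilin_axialRotation]

/-- **Axial symmetry of the Kerr metric** (covariant form): the rotations `R_α` about the axis are
isometries of the Kerr–Schild metric, `g_{M,a}(R_α x)(R_α v, R_α w) = g_{M,a}(x)(v, w)` — the
integrated form of "`∂_φ` is a Killing field" (O'Neill 1995, Ch. 2, §2.2).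
[cite: ONeill1995, Ch. 2 §2.2] -/
theorem bilin_axialRotation (M a α : ℝ) (x v w : E4) :
    bilin M a (E4.axialRotation α x) (E4.axialRotation α v) (E4.axialRotation α w) =
      bilin M a x v w := by
  rw [bilin_apply, bilin_apply, scalarH_axialRotation, nullCovector_axialRotation,
    nullCovector_axialRotation, Minkowski.bilin_axialRotation]

end Kerr

end Literature.Geometry.Lorentzian

end
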